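import Summits.QuantumFields.YangMills.Theorems.InfiniteVolumeShiftDefect
import Summits.QuantumFields.YangMills.Theorems.BalabanLadderInfVolCeilingsDefs
import HarnessLib

/-!
# Infinite volume by compactness, step 11: centre-smeared and base-point-smeared infinite-volume functionals have
# the same limits along ANY DATA tuple of route `InfiniteVolumeContinuum`

HONEST FRAMING (cell `ym-fleet`, seat `ym-infvol-p2`; glue lemma asked for in the route's WAKE note («please land it
once, e.g. `tendsto_centre_iff_base`, so both p1 and p3 cite it»); bears on LADDER-YM R1∕R2a, items
stmt-QuantumFields-19931∕19933).  Pure soft analysis; the only Yang–Mills input is `MomentBounds6 G r a`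
(HYPOTHESIS).  Nothing about rotations, reflection positivity, uniqueness, a mass gap, or Clay.

WHAT IS PROVED ([folklore]).  In the route's own binders — `(hapos : ∀ β, 0 < a β)`, `a → 0`, `MomentBounds6 G r a`,
couplings `β_k → ∞` (so the collar thresholds hold EVENTUALLY, handled by an index shift), states
`μ_k ∈ oddTorusLimitPoints r (β_k)`, `n ≥ 2`, valid `q`, `F ∈ ⁰𝒮ₙ`, weights written with p1's `stateMomentStr`:
* `tendsto_centre_sub_base_zero` — `Σ'ₓ stateMomentStr·F(centres) − Σ'ₓ stateMomentStr·F(base points) → 0`;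
* **`tendsto_base_of_tendsto_centre`**, **`tendsto_centre_of_tendsto_base`**, `tendsto_centre_iff_base` — the two
  smearings converge to the same limit (either both or neither).
So the DATA clause of record (centres) yields base-point convergence, which is what the torus junction
(`exists_torusSides_approximating`, base points = the spine's `latticeDistStr`) and p1's `Q2State`∕`Q3State`
dictionary consume.
-/

set_option autoImplicit false

noncomputable section

open scoped BigOperators SchwartzMap
open MeasureTheory Filter Topology
open Literature.MathematicalPhysics.QuantumFieldTheory hiding ZdEdge
open Literature.MathematicalPhysics.QuantumLattice
open Literature.MathematicalPhysics.AQFT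
open Literature.Probability.LatticeModels (box Site)
open Summit.QuantumFields.YangMills.Cruxes.OSLegsFromFemtoAndGap.DlrCollarTransfer (plane MomentBounds6)

namespace Summit.QuantumFields.YangMills.Theorems.InfiniteVolume

variable {G : Type} [Group G] [TopologicalSpace G] [IsTopologicalGroup G] [CompactSpace G]
  [MeasurableSpace G] [BorelSpace G]

/-- **Centre minus base `→ 0` along any DATA-type sequence.**  `β_k → ∞` (thresholds eventually), `a > 0`, `a → 0`,
`MomentBounds6 G r a`, `μ_k ∈ oddTorusLimitPoints r (β_k)`, `n ≥ 2`, valid `q`, `F ∈ ⁰𝒮ₙ`. [folklore] -/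
theorem tendsto_centre_sub_base_zero (r : LatticeRep G) {a : ℝ → ℝ} (hapos : ∀ β, 0 < a β)
    (ha0 : Tendsto a atTop (𝓝 0)) (hMB : MomentBounds6 G r a) (β : ℕ → ℝ) (hβ : Tendsto β atTop atTop)
    (μ : ℕ → Measure (LGConfig 4 G)) (hμ : ∀ k, μ k ∈ oddTorusLimitPoints r (β k))
    {n : ℕ} (hn : 2 ≤ n) (q : Fin n → Fin 4 × Fin 4) (hq : ∀ i, (q i).1 < (q i).2)
    (F : 𝓢((Fin n → EuclideanSpace ℝ (Fin 4)), ℂ)) (hF : IsOffDiagonal F) :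
    Tendsto (fun k => ∑' x : Fin n → (Fin 4 → ℤ), ((stateMomentStr G r (μ k) n q x : ℝ) : ℂ) *
        F (fun l => a (β k) • siteToE (x l) +
          (a (β k) / 2) • (EuclideanSpace.single (q l).1 (1 : ℝ) + EuclideanSpace.single (q l).2 (1 : ℝ))) -
      ∑' x : Fin n → (Fin 4 → ℤ), ((stateMomentStr G r (μ k) n q x : ℝ) : ℂ) * F (fun l => a (β k) • siteToE (x l)))
      atTop (𝓝 0) := by
  obtain ⟨C, β₄, ℓ₄, hℓ, hC, Hcol⟩ := hMB
  -- thresholds hold from some index `k₀` on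
  obtain ⟨B₁, hB₁⟩ : ∃ B₁ : ℝ, ∀ b, B₁ ≤ b → a b < min (1 / 24) ℓ₄ :=
    Filter.eventually_atTop.1 (ha0.eventually (gt_mem_nhds (by positivity)))
  obtain ⟨k₀, hk₀⟩ := Filter.eventually_atTop.1 (hβ.eventually (eventually_ge_atTop (max β₄ B₁)))
  -- the shifted sequences satisfy the hypotheses of the shift-defect lemma for all indices
  have hβ' : ∀ k, β₄ ≤ β (k + k₀) := fun k => le_trans (le_max_left _ _) (hk₀ _ (Nat.le_add_left _ _))
  have hB' : ∀ k, B₁ ≤ β (k + k₀) := fun k => le_trans (le_max_right _ _) (hk₀ _ (Nat.le_add_left _ _))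
  have ha' : ∀ k, 0 < a (β (k + k₀)) := fun k => hapos _
  have ha24' : ∀ k, a (β (k + k₀)) ≤ 1 / 24 := fun k => (hB₁ _ (hB' k)).le.trans (min_le_left _ _)
  have haℓ' : ∀ k, a (β (k + k₀)) ≤ ℓ₄ := fun k => (hB₁ _ (hB' k)).le.trans (min_le_right _ _)
  have ha0' : Tendsto (fun k => a (β (k + k₀))) atTop (𝓝 0) :=
    (ha0.comp hβ).comp (tendsto_add_atTop_nat k₀)
  have hc : ∀ (k : ℕ) (l : Fin n), ‖(a (β (k + k₀)) / 2) •
      (EuclideanSpace.single (q l).1 (1 : ℝ) + EuclideanSpace.single (q l).2 (1 : ℝ))‖ ≤ a (β (k + k₀)) :=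
    fun k l => by
      rw [norm_smul, Real.norm_of_nonneg (by linarith [(ha' k).le] : (0 : ℝ) ≤ a (β (k + k₀)) / 2)]
      have h1 : ‖EuclideanSpace.single (q l).1 (1 : ℝ) + EuclideanSpace.single (q l).2 (1 : ℝ)‖ ≤ 2 := by
        have e1 : ‖EuclideanSpace.single (q l).1 (1 : ℝ)‖ = 1 := by
          rw [show EuclideanSpace.single (q l).1 (1 : ℝ) = PiLp.single 2 (q l).1 (1 : ℝ) from rfl,
            PiLp.norm_single 2 (fun _ : Fin 4 => ℝ) (q l).1 (1 : ℝ), norm_one]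
        have e2 : ‖EuclideanSpace.single (q l).2 (1 : ℝ)‖ = 1 := by
          rw [show EuclideanSpace.single (q l).2 (1 : ℝ) = PiLp.single 2 (q l).2 (1 : ℝ) from rfl,
            PiLp.norm_single 2 (fun _ : Fin 4 => ℝ) (q l).2 (1 : ℝ), norm_one]
        calc _ ≤ ‖EuclideanSpace.single (q l).1 (1 : ℝ)‖ + ‖EuclideanSpace.single (q l).2 (1 : ℝ)‖ :=
              norm_add_le _ _
          _ = 2 := by rw [e1, e2]; norm_num
      nlinarith [(ha' k).le]
  have h := tendsto_tsum_shift_sub_base r hℓ hC Hcol (fun k => β (k + k₀)) hβ' ha' ha24' haℓ' ha0'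
    (fun k => μ (k + k₀)) (fun k => hμ _) hn q hq
    (fun k l => (a (β (k + k₀)) / 2) • (EuclideanSpace.single (q l).1 (1 : ℝ) + EuclideanSpace.single (q l).2 (1 : ℝ)))
    hc F hF
  -- unshift the index
  rw [← tendsto_add_atTop_iff_nat k₀]
  exact h

/-- **Base-point convergence from centre convergence.** [folklore] -/
theorem tendsto_base_of_tendsto_centre (r : LatticeRep G) {a : ℝ → ℝ} (hapos : ∀ β, 0 < a β)
    (ha0 : Tendsto a atTop (𝓝 0)) (hMB : MomentBounds6 G r a) (β : ℕ → ℝ) (hβ : Tendsto β atTop atTop)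
    (μ : ℕ → Measure (LGConfig 4 G)) (hμ : ∀ k, μ k ∈ oddTorusLimitPoints r (β k))
    {n : ℕ} (hn : 2 ≤ n) (q : Fin n → Fin 4 × Fin 4) (hq : ∀ i, (q i).1 < (q i).2)
    (F : 𝓢((Fin n → EuclideanSpace ℝ (Fin 4)), ℂ)) (hF : IsOffDiagonal F) {z : ℂ}
    (h : Tendsto (fun k => ∑' x : Fin n → (Fin 4 → ℤ), ((stateMomentStr G r (μ k) n q x : ℝ) : ℂ) *
        F (fun l => a (β k) • siteToE (x l) +
          (a (β k) / 2) • (EuclideanSpace.single (q l).1 (1 : ℝ) + EuclideanSpace.single (q l).2 (1 : ℝ))))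
        atTop (𝓝 z)) :
    Tendsto (fun k => ∑' x : Fin n → (Fin 4 → ℤ), ((stateMomentStr G r (μ k) n q x : ℝ) : ℂ) *
        F (fun l => a (β k) • siteToE (x l))) atTop (𝓝 z) := by
  have hd := tendsto_centre_sub_base_zero r hapos ha0 hMB β hβ μ hμ hn q hq F hF
  have h2 := h.sub hd
  rw [sub_zero] at h2
  refine h2.congr fun k => ?_
  simp only [sub_sub_cancel]

/-- **Centre convergence from base-point convergence.** [folklore] -/
theorem tendsto_centre_of_tendsto_base (r : LatticeRep G) {a : ℝ → ℝ} (hapos : ∀ β, 0 < a β)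
    (ha0 : Tendsto a atTop (𝓝 0)) (hMB : MomentBounds6 G r a) (β : ℕ → ℝ) (hβ : Tendsto β atTop atTop)
    (μ : ℕ → Measure (LGConfig 4 G)) (hμ : ∀ k, μ k ∈ oddTorusLimitPoints r (β k))
    {n : ℕ} (hn : 2 ≤ n) (q : Fin n → Fin 4 × Fin 4) (hq : ∀ i, (q i).1 < (q i).2)
    (F : 𝓢((Fin n → EuclideanSpace ℝ (Fin 4)), ℂ)) (hF : IsOffDiagonal F) {z : ℂ}
    (h : Tendsto (fun k => ∑' x : Fin n → (Fin 4 → ℤ), ((stateMomentStr G r (μ k) n q x : ℝ) : ℂ) *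
        F (fun l => a (β k) • siteToE (x l))) atTop (𝓝 z)) :
    Tendsto (fun k => ∑' x : Fin n → (Fin 4 → ℤ), ((stateMomentStr G r (μ k) n q x : ℝ) : ℂ) *
        F (fun l => a (β k) • siteToE (x l) +
          (a (β k) / 2) • (EuclideanSpace.single (q l).1 (1 : ℝ) + EuclideanSpace.single (q l).2 (1 : ℝ))))
        atTop (𝓝 z) := by
  have hd := tendsto_centre_sub_base_zero r hapos ha0 hMB β hβ μ hμ hn q hq F hF
  have h2 := hd.add h
  rw [zero_add] at h2
  refine h2.congr fun k => ?_
  simp only [sub_add_cancel]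

/-- **The two smearings have the same limits.** [folklore] -/
theorem tendsto_centre_iff_base (r : LatticeRep G) {a : ℝ → ℝ} (hapos : ∀ β, 0 < a β)
    (ha0 : Tendsto a atTop (𝓝 0)) (hMB : MomentBounds6 G r a) (β : ℕ → ℝ) (hβ : Tendsto β atTop atTop)
    (μ : ℕ → Measure (LGConfig 4 G)) (hμ : ∀ k, μ k ∈ oddTorusLimitPoints r (β k))
    {n : ℕ} (hn : 2 ≤ n) (q : Fin n → Fin 4 × Fin 4) (hq : ∀ i, (q i).1 < (q i).2)
    (F : 𝓢((Fin n → EuclideanSpace ℝ (Fin 4)), ℂ)) (hF : IsOffDiagonal F) (z : ℂ) :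
    Tendsto (fun k => ∑' x : Fin n → (Fin 4 → ℤ), ((stateMomentStr G r (μ k) n q x : ℝ) : ℂ) *
        F (fun l => a (β k) • siteToE (x l) +
          (a (β k) / 2) • (EuclideanSpace.single (q l).1 (1 : ℝ) + EuclideanSpace.single (q l).2 (1 : ℝ))))
        atTop (𝓝 z) ↔
      Tendsto (fun k => ∑' x : Fin n → (Fin 4 → ℤ), ((stateMomentStr G r (μ k) n q x : ℝ) : ℂ) *
        F (fun l => a (β k) • siteToE (x l))) atTop (𝓝 z) :=
  ⟨tendsto_base_of_tendsto_centre r hapos ha0 hMB β hβ μ hμ hn q hq F hF,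
    tendsto_centre_of_tendsto_base r hapos ha0 hMB β hβ μ hμ hn q hq F hF⟩

end Summit.QuantumFields.YangMills.Theorems.InfiniteVolume

end
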